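import Summits.QuantumFields.BalabanUV.T4Continuum.Spine.NE5.TwoRunTorusParam
import Summits.QuantumFields.BalabanUV.T4Continuum.Spine.NE5.TwoRunTorusWalkParam
import Summits.QuantumFields.BalabanUV.T4Continuum.Spine.NE5.TwoRunTorusWalkRePos

/-!
# Spine/NE5/TwoRunTorusWalkOutputLetters — T26 with NODE A's positivity and the operator letters `c_E`, `g` READ FROM
# THE WALK RECORDS (T28): the torus chain's output along any parameter from per-term records + SYMMETRY
# (cell `pub-balaban-gaps`, seat `ne5` gen 9)

WHY.  T26 `TwoRunTorusWalkOutput.differentiableOn_E_torus_of_termWalkData` (T17 fed by T25 per term) still carries, per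
term, NODE A's positivity `hA` (`Re A(σ,b) ≻ 0` on the closed polydisc × closed ball) and two operator letters with
their hypotheses: the spectral letter `c_E` (`hc : λ_k(C) ≤ c_E`, `hc0`) and the Γ₀-form letter `g` (`hΓq`, `hg`).
T28 `TwoRunTorusWalkRePos` derives all three from the same walk record: `re_posDef_on_ball_of_termWalkData` (record +
SYMMETRY + one smallness), `eigenvalues_le_of_termWalkData` (`λ_max(C) ≤ K̄_C·𝒦.m·(1+2∕w.κ)^ν`),
`gammaForm_le_of_termWalkData` (`⟨Γ₀X, CΓ₀X⟩ ≤ (K̄_C·𝒦.m·(1+2∕w.κ)^ν)(K̄_Γ·m·(1+2∕w.κ)^ν)²‖X‖²`).  THIS FILE is T26 §1 with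
those three inputs REPLACED by envelope inequalities in the record's letters — `hcE : K̄_C·m·(1+2∕w.κ)^ν ≤ c_E`,
`hgE : c_E·(K̄_Γ·m·(1+2∕w.κ)^ν)² ≤ g`, `hsmallRe : θ_E(w,α)·(m·(1+2∕w.κ)^ν)·c_E < 1` — so that, per term, what the
builder hands is: the record (`TermWalkData`, ONE admissible `w`, `SmallTheta`), σ-holomorphy of its kernels (free for
local families — T27; (x12) for walk series), SYMMETRY of the precision, the potentials with (2.20), the common `χ` with
(2.22), the column fibre bound (x10), and numerics in `(K̄_Γ, K̄_E, K̄_C, m, ν, rates, θ, c_E, g, γ₂, a₂₀, w₂₀, …)` with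
`c_E`, `g` constrained only from below by the record's letters ((x11) made explicit).  Conclusion = T17's on `ball 0 α`.

HONEST FRAMING.  Pure composition of LANDED ∕ staged shapes (T17; T25; T28); every record, family, region and number is
a HYPOTHESIS; nothing of Bałaban's is constructed or asserted; whether his operators admit such records is NODE O's
statement (v)⁺, not claimed; NE5 NOT PRINTED ∕ NOT PROVED; leaves 0∕12; (D4) 0∕1; spine 0∕9.  Rung (B)+1 on a FIXED
finite T⁴ — NOT continuum, NOT infinite volume, NOT mass gap, NOT Clay.  HONEST DEPENDENCY: continuum YM on T⁴ ⇐
BetaPertH ∧ nine spine estimates; BetaPertH ⇐ (D1) ∧ (D4) ∧ CAP+tail.  0 sorry, 0 `def`.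

Sources: [II] = T. Bałaban, CMP **116** (1988) [Balaban1988RG2Cluster] (2.13) p. 14, (2.14)–(2.26) pp. 15–17, Lemma 3
(2.38) p. 20, (2.41) p. 21; [B9] = CMP **99** (1985) [Balaban1985BackgroundPropagators] Thm 3.10 p. 416; C. King, CMP
**102** (1986) [King1986] p. 665.  Nothing here is a claim about the Yang–Mills mass gap.
-/

noncomputable section

namespace Summit.QuantumFields.BalabanUV.T4Continuum.Spine.NE5.TwoRunTorusWalkOutputLetters

open Matrix Metric Set Finset
open Literature.MathematicalPhysics.QuantumFieldTheory.Balaban1983to89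
open Literature.MathematicalPhysics.QuantumFieldTheory.Balaban1983to89.TreeLengthTorus (TPt TDom tsys)
open Literature.MathematicalPhysics.QuantumFieldTheory.Balaban1983to89.TreeLengthTorusGeometry (TTouch)
open Literature.MathematicalPhysics.QuantumFieldTheory.Balaban1983to89.TreeLengthTorusTransfer (tclosure)
open Literature.MathematicalPhysics.QuantumFieldTheory.Balaban1983to89.B13Lemma3TorusData (TBond)
open Literature.MathematicalPhysics.QuantumFieldTheory.Balaban1983to89.B13Lemma3Torus (TwoTorusStep)
open Literature.MathematicalPhysics.QuantumFieldTheory.Balaban1983to89.B13Lemma3TorusTerms (terms weight Z0)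
open Literature.MathematicalPhysics.QuantumFieldTheory.Balaban1983to89.B13Term214 (core214 F214 term214)
open Literature.MathematicalPhysics.QuantumFieldTheory.Balaban1983to89.B13Bound143 (invTau)
open Literature.MathematicalPhysics.QuantumFieldTheory.Balaban1983to89.B5TorusCover (UT)
open Literature.MathematicalPhysics.QuantumFieldTheory.Balaban1983to89.B12TreeDecay (kappa₀ K₀)
open Literature.MathematicalPhysics.QuantumFieldTheory.Balaban1983to89.B13Resummation (locE)
open Literature.MathematicalPhysics.QuantumFieldTheory.Balaban1983to89.B13TermWalkData
  (WalkConsts TermKernels TermWalkData)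
open Literature.MathematicalPhysics.QuantumFieldTheory.Balaban1983to89.B13TermWalkDataOneTorus (SmallTheta)
open Summit.QuantumFields.BalabanUV.T4Continuum.Spine.NE5.TwoRunTorusParam (differentiableOn_E_torus_param)
open Summit.QuantumFields.BalabanUV.T4Continuum.Spine.NE5.TwoRunTorusWalkParam
  (hol_and_h226_torus_of_termWalkData_param)
open Summit.QuantumFields.BalabanUV.T4Continuum.Spine.NE5.TwoRunTorusWalkRePos
  (re_posDef_on_ball_of_termWalkData eigenvalues_le_of_termWalkData gammaForm_le_of_termWalkData)

variable {L N' : ℕ} [NeZero L] [NeZero N'] {M : ℕ} [NeZero M]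
variable {ν : ℕ} {Nf : Fin ν → ℕ} [∀ i, NeZero (Nf i)]
variable {B : Type*} [NormedAddCommGroup B] [NormedSpace ℂ B]

/-! ## The output along any parameter from per-term walk records + symmetry, letters from the records -/

open Classical in
/-- **THE TORUS CHAIN'S OUTPUT ALONG ANY PARAMETER FROM PER-TERM WALK RECORDS AND SYMMETRY, THE OPERATOR LETTERS READ
FROM THE RECORDS.**  T26 `differentiableOn_E_torus_of_termWalkData` with (per term) NODE A's positivity `hA`, the
spectral hypothesis `hc` and the Γ₀-form hypothesis `hΓq` REPLACED by T28's derivations from the record: the only new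
binders are the envelopes `hcE : K̄_C·m·(1+2∕w.κ)^ν ≤ c_E`, `hgE : c_E·(K̄_Γ·m·(1+2∕w.κ)^ν)² ≤ g` and the positivity
smallness `hsmallRe : θ_E(w,α)·(m·(1+2∕w.κ)^ν)·c_E < 1` (`θ_E(w,α) = 2K̄_Ee^{−εR_σ} + 2K̄_Eα∕R`); everything else as in
T26 (records with ONE admissible package and `SmallTheta`, σ-holomorphy, SYMMETRY on the closed polydisc × closed ball,
potentials with (2.20), common `χ` with (2.22), column fibre bound, rates, numerics, (2.13), space restriction, Lemma 3's
∕ (2.39)–(2.41)'s numbers).  Conclusion: for every `X` and `φ ∈ sp2 X`, `b ↦ E^b(X)(φ)` is holomorphic on `ball 0 α`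
with `‖E^b(X)(φ)‖ ≤ A₂C₃ε₁e^{−(1−10δ)½Lκd_{k+1}(X)}`.
[cite: Balaban1988RG2Cluster, (2.13) p.14, (2.14)–(2.26) pp.15–17, (2.38) p.20, (2.41) p.21; Balaban1985BackgroundPropagators, Thm 3.10 p.416; King1986, p.665] -/
theorem differentiableOn_E_torus_of_records_symm (c : B13.Consts) (hL : 8 ≤ c.L) (hLc : c.L = L) (hκ₁ : 1 ≤ c.κ₁)
    (hα₆' : c.α₆ ≠ 0) (W : TwoTorusStep 4 L N')
    -- regions, radii, contour radius, parameter lists (common to the family)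
    (hpos : ∀ Y : TDom 4 (L * N'), 0 < invTau c ((tsys 4 (L * N')).dj Y))
    (hhalf : ∀ Y : TDom 4 (L * N'), invTau c ((tsys 4 (L * N')).dj Y) ≤ 1 / 2)
    {Uτ : TDom 4 (L * N') → Set ℂ} (hUτ : ∀ Y, IsOpen (Uτ Y))
    (hUtau : ∀ Y : TDom 4 (L * N'), closedBall (0 : ℂ) ((invTau c ((tsys 4 (L * N')).dj Y))⁻¹) ⊆ Uτ Y)
    {r : ℝ} (hr : 0 < r) (hr' : r ≤ Real.exp c.κ₁ - 1)
    (hsubτ : ∀ Y, ∀ s ∈ Set.uIcc (0 : ℝ) 1, closedBall (s : ℂ) r ⊆ Uτ Y)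
    (lZ : TDom 4 N' → Finset (TDom 4 (L * N')) × Finset (TBond 4 M (L * N')) → List (TPt 4 N'))
    (hlZ : ∀ Z t, (lZ Z t).Nodup ∧ (lZ Z t).toFinset = Z.1 \ tclosure L N' (Z0 M t))
    (lD : Finset (TDom 4 (L * N')) × Finset (TBond 4 M (L * N')) → List (TDom 4 (L * N')))
    (hlD : ∀ t, (lD t).Nodup ∧ (lD t).toFinset = t.1)
    -- PER-TERM WALK RECORDS AT `c⁺` OVER THE PARAMETER SPACE, ONE ADMISSIBLE PACKAGE
    (𝒦 : (Z : TDom 4 N') → Finset (TDom 4 (L * N')) × Finset (TBond 4 M (L * N')) → W.Φ →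
      TermKernels ({ c with κ₁ := c.κ₁ + 1 } : B13.Consts) 4 N' ν Nf B)
    [∀ Z t φ, Fintype (𝒦 Z t φ).C₀] [∀ Z t φ, DecidableEq (𝒦 Z t φ).C₀]
    {w : WalkConsts} {α Rσ₀ : ℝ} (hw : w.Admissible α Rσ₀) (hα : 0 < α)
    (h𝒦 : ∀ Z, ∀ t ∈ terms L M Z, ∀ φ, φ ∈ W.sp2 Z → TermWalkData (𝒦 Z t φ) w)
    (Γ : (Z : TDom 4 N') → (t : Finset (TDom 4 (L * N')) × Finset (TBond 4 M (L * N'))) → (φ : W.Φ) → B →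
      (TPt 4 N' → ℂ) → ((𝒦 Z t φ).Λ ⊕ (𝒦 Z t φ).C₀ → ℝ) → ((𝒦 Z t φ).Λ → ℂ))
    (hlin : ∀ Z, ∀ t ∈ terms L M Z, ∀ φ, φ ∈ W.sp2 Z → ∀ b ∈ ball (0 : B) α, ∀ σ : TPt 4 N' → ℂ,
      (∀ j, σ j ∈ ball (0 : ℂ) (Real.exp (c.κ₁ + 1))) →
        ∀ X : (𝒦 Z t φ).Λ ⊕ (𝒦 Z t φ).C₀ → ℝ, Γ Z t φ b σ X = (𝒦 Z t φ).G2 σ b *ᵥ fun j => (X j : ℂ))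
    (χY₀ χcP : (Z : TDom 4 N') → (t : Finset (TDom 4 (L * N')) × Finset (TBond 4 M (L * N'))) → (φ : W.Φ) →
      ((𝒦 Z t φ).Λ → ℝ) → ℝ)
    (hχ0 : ∀ Z t φ Bf, 0 ≤ χY₀ Z t φ Bf) (hχc0 : ∀ Z t φ Bf, 0 ≤ χcP Z t φ Bf)
    (Dfam : TDom 4 N' → Finset (TDom 4 (L * N')) × Finset (TBond 4 M (L * N')) → Finset (TDom 4 (L * N')))
    (Vk : (Z : TDom 4 N') → (t : Finset (TDom 4 (L * N')) × Finset (TBond 4 M (L * N'))) → (φ : W.Φ) → B →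
      TDom 4 (L * N') → ((𝒦 Z t φ).Λ → ℝ) → ℂ)
    -- non-walk data: σ-holomorphy, symmetry ∕ `Re ≻ 0`, potentials, measurability
    (hAhol : ∀ Z, ∀ t ∈ terms L M Z, ∀ φ, φ ∈ W.sp2 Z → ∀ b ∈ ball (0 : B) α, ∀ i j,
      DifferentiableOn ℂ (fun σ => (𝒦 Z t φ).A2 σ b i j) {σ | ∀ j, σ j ∈ ball (0 : ℂ) (Real.exp (c.κ₁ + 1))})
    (hGhol : ∀ Z, ∀ t ∈ terms L M Z, ∀ φ, φ ∈ W.sp2 Z → ∀ b ∈ ball (0 : B) α, ∀ i j,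
      DifferentiableOn ℂ (fun σ => (𝒦 Z t φ).G2 σ b i j) {σ | ∀ j, σ j ∈ ball (0 : ℂ) (Real.exp (c.κ₁ + 1))})
    (hVholb : ∀ Z, ∀ t ∈ terms L M Z, ∀ φ, φ ∈ W.sp2 Z → ∀ Y Bf,
      DifferentiableOn ℂ (fun b => Vk Z t φ b Y Bf) (ball (0 : B) α))
    (hχm : ∀ Z t φ, Measurable (χY₀ Z t φ)) (hχcm : ∀ Z t φ, Measurable (χcP Z t φ))
    (hVm : ∀ Z, ∀ t ∈ terms L M Z, ∀ φ, φ ∈ W.sp2 Z → ∀ b ∈ ball (0 : B) α, ∀ Y, Measurable (Vk Z t φ b Y))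
    (hAs : ∀ Z, ∀ t ∈ terms L M Z, ∀ φ, φ ∈ W.sp2 Z → ∀ b : B, ‖b‖ ≤ α → ∀ σ : TPt 4 N' → ℂ,
      (∀ j, ‖σ j‖ ≤ Real.exp (c.κ₁ + 1)) → ((𝒦 Z t φ).A2 σ b).IsSymm)
    -- (2.22) and (2.20), uniform along the parameter
    {γ₂ rP a₂₀ w₂₀ : ℝ}
    (qP : (Z : TDom 4 N') → (t : Finset (TDom 4 (L * N')) × Finset (TBond 4 M (L * N'))) → (φ : W.Φ) →
      ((𝒦 Z t φ).Λ → ℝ) → ℝ)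
    (h222 : ∀ Z t φ Bf, χY₀ Z t φ Bf * χcP Z t φ Bf ≤
      Real.exp (-(γ₂ / 2 * rP ^ 2 * (t.2.card : ℕ)) + γ₂ / 2 * qP Z t φ Bf))
    (hγ₂ : 0 ≤ γ₂) (hqP : ∀ Z t φ Bf, qP Z t φ Bf ≤ Bf ⬝ᵥ Bf) (ha0 : 0 ≤ a₂₀)
    (h220U : ∀ Z, ∀ t ∈ terms L M Z, ∀ φ, φ ∈ W.sp2 Z → ∀ b ∈ ball (0 : B) α, ∀ τ : TDom 4 (L * N') → ℂ,
      (∀ Y, τ Y ∈ Uτ Y) → ∀ Bf, ∑ Y ∈ Dfam Z t, ‖τ Y‖ * ‖Vk Z t φ b Y Bf‖ ≤ a₂₀ / 2 * (Bf ⬝ᵥ Bf) + w₂₀)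
    -- a common fibre bound
    {m : ℕ} (hm : ∀ Z t φ, (𝒦 Z t φ).m ≤ m)
    (hfibN : ∀ Z t φ, ∀ x : UT Nf, (Finset.univ.filter fun j => (𝒦 Z t φ).locN j = x).card ≤ m)
    -- one package of rates and p. 17 numerics in the record's letters
    {κa κb kap' kap'' θ : ℝ} (hκa : κa < w.kap) (hκb : κb < κa) (h2 : kap' < κb) (h1 : kap'' < kap')
    (hkap'' : 0 < kap'')
    (hsm : SmallTheta w α θ)
    (hθR1le : ∀ Z t φ, ((m : ℝ) * (1 + 2 / (κb - kap')) ^ ν) * (m * (1 + 2 / (kap' - kap'')) ^ ν)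
      * ((2 * w.KbarΓ * Real.exp (-(w.ε * w.Rσ)) + 2 * w.KbarΓ * α / w.R) * w.KbarC * w.KbarΓ
        + w.KbarΓ * (w.KbarC * (2 * w.KbarE * Real.exp (-(w.ε * w.Rσ)) + 2 * w.KbarE * α / w.R)
            * ((𝒦 Z t φ).m * (1 + 2 / (w.kap - κa)) ^ ν) * w.KbarC * ((𝒦 Z t φ).m * (1 + 2 / (κa - κb)) ^ ν))
            * w.KbarΓ
        + w.KbarΓ * w.KbarC * (2 * w.KbarΓ * Real.exp (-(w.ε * w.Rσ)) + 2 * w.KbarΓ * α / w.R)) ≤ θ)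
    (hsmallKθ : w.KbarC * (m * (1 + 2 / κb) ^ ν) * (θ * (m * (1 + 2 / kap'') ^ ν)) < 1)
    -- the operator letters `c_E`, `g` constrained FROM BELOW by the records' letters (T28), and NODE A's smallness
    {cE g : ℝ} (hcE : w.KbarC * (m * (1 + 2 / w.kap) ^ ν) ≤ cE)
    (hgE : cE * (w.KbarΓ * (m * (1 + 2 / w.kap) ^ ν)) ^ 2 ≤ g)
    (hsmallRe : (2 * w.KbarE * Real.exp (-(w.ε * w.Rσ)) + 2 * w.KbarE * α / w.R)
      * (m * (1 + 2 / w.kap) ^ ν) * cE < 1)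
    (hαc : (2 * (θ * (m * (1 + 2 / kap'') ^ ν)) + (γ₂ + a₂₀)) * cE ≤ 1 / 2)
    (hsmall : (2 * (θ * (m * (1 + 2 / kap'') ^ ν)) + (γ₂ + a₂₀)) * (1 + 2 * cE * g) ≤ 1 / 2)
    {a a₅ : ℝ} (hPa : a ≤ γ₂ * rP ^ 2)
    (hvol : ∀ Z, ∀ t ∈ terms L M Z, ∀ φ, φ ∈ W.sp2 Z →
      2 * (w.KbarC * (m * (1 + 2 / κb) ^ ν) * (θ * (m * (1 + 2 / kap'') ^ ν))
              * (1 + (1 - w.KbarC * (m * (1 + 2 / κb) ^ ν) * (θ * (m * (1 + 2 / kap'') ^ ν)))⁻¹) / 2)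
          * (Fintype.card (𝒦 Z t φ).Λ : ℝ)
        + w₂₀ + (2 * (θ * (m * (1 + 2 / kap'') ^ ν)) + (γ₂ + a₂₀)) * cE * (Fintype.card (𝒦 Z t φ).Λ : ℝ)
        + (2 * (θ * (m * (1 + 2 / kap'') ^ ν)) + (γ₂ + a₂₀)) * (1 + 2 * cE * g)
          * (Fintype.card ((𝒦 Z t φ).Λ ⊕ (𝒦 Z t φ).C₀) : ℝ)
        ≤ a₅ * ((Z.1).card : ℝ))
    -- Lemma 3's and (2.39)–(2.41)'s numbers, verbatim as in T17
    {a₂ a₂' Aabs : ℝ}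
    (hα₆ : 0 < c.α₆) (hε₀ : 0 ≤ c.eps2) (hδ : 0 ≤ c.δ) (hδ7 : 0 ≤ 1 - 7 * c.δ) (hκ : 0 ≤ c.κ) (ha : 0 ≤ a)
    (hR15 : c.R15) (hR16 : 18 * ((1 - 4 * c.δ) * c.κ) ≤ a / 20) (hR16' : 4 * c.κ ≤ a / 20)
    (hR17 : Real.exp (-(a / 20)) ≤ c.eps2) (h231 : 2 * (4 : ℝ) * (M : ℝ) ^ 4 * Real.exp (-(a / 10)) ≤ a / 20)
    (ha₂ : 0 ≤ a₂) (hκ229 : kappa₀ 64 8 + a₂ ≤ c.δ * c.κ)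
    (hsm229 : c.α₆ * Real.exp a₂ * K₀ 64 8 * 64 ≤ a₂)
    (habsk : Real.exp (-(a / 20)) * 64 ≤ c.δ * c.κ)
    (h18half : B13Step237.R18half c (K₀ 64 8 * Real.exp (Real.exp (-(a / 20)) * 64)))
    (h18 : B13Step237.R18sharp c (K₀ 64 8 * Real.exp (Real.exp (-(a / 20)) * 64)) ((c.L : ℝ) / 2))
    (ha₂' : 0 ≤ a₂') (hκ229' : kappa₀ 64 8 + a₂' ≤ c.δ * ((c.L : ℝ) / 2) * c.κ)
    (hsm229' : c.α₆ * Real.exp a₂' * K₀ 64 8 * 64 ≤ a₂')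
    (hR20 : 18 * ((1 - 7 * c.δ) * ((c.L : ℝ) / 2) * c.κ) ≤ (c.κ₁ - 1) / 2)
    (ha₅ : 0 ≤ a₅) (habs : a₅ + Real.exp (-((c.κ₁ - 1) / 2)) ≤ Aabs)
    (hAc : Aabs * 64 ≤ c.δ * ((c.L : ℝ) / 2) * c.κ)
    (hC3 : B13Step237.bracketF c (K₀ 64 8 * Real.exp (Real.exp (-(a / 20)) * 64)) / c.α₆ *
      Real.exp (Aabs * 64) ≤ c.C3act * c.ε₁)
    -- the members' activities are the sums of the (2.14)-terms read from the records; (2.13); space restriction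
    {H : B → TDom 4 N' → W.Φ → ℂ}
    (hH : ∀ b ∈ ball (0 : B) α, ∀ (Z : TDom 4 N') (φ : W.Φ), φ ∈ W.sp2 Z → H b Z φ = ∑ t ∈ terms L M Z,
      term214 r (lZ Z t) (lD t) (core214 (fun σ => (𝒦 Z t φ).A2 σ b) (Γ Z t φ b)
        (F214 t.2.card (χY₀ Z t φ) (χcP Z t φ) (Dfam Z t) (Vk Z t φ b))) 0 0)
    (hsp : ∀ X Z : TDom 4 N', ∀ φ, Z.1 ⊆ X.1 → φ ∈ W.sp2 X → φ ∈ W.sp2 Z)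
    {E : B → TDom 4 N' → W.Φ → ℂ}
    (h213 : ∀ b ∈ ball (0 : B) α, ∀ (X : TDom 4 N') (φ : W.Φ), φ ∈ W.sp2 X →
      E b X φ = locE (TTouch (d := 4) (N := N')) (fun Z : TDom 4 N' => Z.1) (fun Z => H b Z φ) X.1)
    (hAct : 0 ≤ c.C3act * c.ε₁) (hr₁ : 0 ≤ (1 - 10 * c.δ) * ((c.L : ℝ) / 2) * c.κ)
    (hlarge : (1 - 10 * c.δ) * ((c.L : ℝ) / 2) * c.κ + 2 * (64 * Real.log 162) + 2 ≤
      (1 - 8 * c.δ) * ((c.L : ℝ) / 2) * c.κ)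
    (hsmall41 : c.C3act * c.ε₁ * Real.exp (5 * ((1 - 10 * c.δ) * ((c.L : ℝ) / 2) * c.κ) + 1) * K₀ 64 8 * 9 * 64 ≤ 1)
    (hA₂ : Real.exp 1 * 9 * 64 * K₀ 64 8 ^ 2 ≤ c.A₂) :
    ∀ (X : TDom 4 N') (φ : W.Φ), φ ∈ W.sp2 X →
      DifferentiableOn ℂ (fun b => E b X φ) (ball (0 : B) α) ∧
        ∀ b ∈ ball (0 : B) α, ‖E b X φ‖ ≤
          c.A₂ * c.C3act * c.ε₁ * Real.exp (-((1 - 10 * c.δ) * ((c.L : ℝ) / 2) * c.κ * (tsys 4 N').dj X)) := by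
  -- the (2.14)-term families read from the records
  let P : (Z : TDom 4 N') → Finset (TDom 4 (L * N')) × Finset (TBond 4 M (L * N')) → W.Φ → B → ℂ :=
    fun Z t φ b => term214 r (lZ Z t) (lD t) (core214 (fun σ => (𝒦 Z t φ).A2 σ b) (Γ Z t φ b)
      (F214 t.2.card (χY₀ Z t φ) (χcP Z t φ) (Dfam Z t) (Vk Z t φ b))) 0 0
  -- the letters from the records (T28): positivity, spectral bound, Γ₀-form bound, per term
  have hα0 : 0 ≤ α := hα.le
  have hKc0 : 0 ≤ (1 + 2 / w.kap) ^ ν := by have := hw.hkap; positivity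
  have hθE0 : 0 ≤ 2 * w.KbarE * Real.exp (-(w.ε * w.Rσ)) + 2 * w.KbarE * α / w.R := by
    have := hw.hKbarE; have := hα.trans hw.hαR; positivity
  have hmKc : ∀ Z t φ, ((𝒦 Z t φ).m : ℝ) * (1 + 2 / w.kap) ^ ν ≤ m * (1 + 2 / w.kap) ^ ν := fun Z t φ =>
    mul_le_mul_of_nonneg_right (by exact_mod_cast hm Z t φ) hKc0
  have hc0 : 0 ≤ cE := le_trans (by have := hw.hKbarC; positivity) hcE
  have hg : 0 ≤ g := le_trans (by positivity) hgE
  have hc : ∀ Z, ∀ t ∈ terms L M Z, ∀ φ, φ ∈ W.sp2 Z → ∀ k, (𝒦 Z t φ).hC.1.eigenvalues k ≤ cE :=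
    fun Z t ht φ hφ k => ((eigenvalues_le_of_termWalkData hw hα0 (h𝒦 Z t ht φ hφ) k).trans
      (mul_le_mul_of_nonneg_left (hmKc Z t φ) hw.hKbarC)).trans hcE
  have hA : ∀ Z, ∀ t ∈ terms L M Z, ∀ φ, φ ∈ W.sp2 Z → ∀ b : B, ‖b‖ ≤ α → ∀ σ : TPt 4 N' → ℂ,
      (∀ j, ‖σ j‖ ≤ Real.exp (c.κ₁ + 1)) → (((𝒦 Z t φ).A2 σ b).map Complex.re).PosDef :=
    fun Z t ht φ hφ => re_posDef_on_ball_of_termWalkData hw hα0 (h𝒦 Z t ht φ hφ) (hAs Z t ht φ hφ) (hc Z t ht φ hφ)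
      ((mul_le_mul_of_nonneg_right (mul_le_mul_of_nonneg_left (hmKc Z t φ) hθE0) hc0).trans_lt hsmallRe)
  have hΓq : ∀ Z, ∀ t ∈ terms L M Z, ∀ φ, φ ∈ W.sp2 Z → ∀ X : (𝒦 Z t φ).Λ ⊕ (𝒦 Z t φ).C₀ → ℝ,
      ((𝒦 Z t φ).Γ₀ *ᵥ X) ⬝ᵥ ((𝒦 Z t φ).C *ᵥ ((𝒦 Z t φ).Γ₀ *ᵥ X)) ≤ g * (X ⬝ᵥ X) := by
    intro Z t ht φ hφ X
    have hXX : 0 ≤ X ⬝ᵥ X := by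
      simp only [dotProduct]; exact Finset.sum_nonneg fun i _ => mul_self_nonneg _
    refine (gammaForm_le_of_termWalkData hw hα0 (h𝒦 Z t ht φ hφ) (hm Z t φ) (hfibN Z t φ) X).trans
      (mul_le_mul_of_nonneg_right ?_ hXX)
    refine le_trans ?_ hgE
    exact mul_le_mul_of_nonneg_right ((mul_le_mul_of_nonneg_left (hmKc Z t φ) hw.hKbarC).trans hcE) (sq_nonneg _)
  -- T25 per term and configuration
  have key : ∀ (Z : TDom 4 N') (φ : W.Φ), φ ∈ W.sp2 Z → ∀ t ∈ terms L M Z,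
      DifferentiableOn ℂ (P Z t φ) (ball (0 : B) α) ∧
        ∀ b ∈ ball (0 : B) α, ‖P Z t φ b‖ ≤ weight L M c Z a t * Real.exp (a₅ * ((Z.1).card : ℝ)) := by
    intro Z φ hφ t ht
    exact hol_and_h226_torus_of_termWalkData_param c hκ₁ hα₆' Z t hpos hhalf hUτ hUtau hr hr' hsubτ (lZ Z t)
      (hlZ Z t) (lD t) (hlD t) (𝒦 Z t φ) hw hα (h𝒦 Z t ht φ hφ) (Γ Z t φ) (hlin Z t ht φ hφ) (χY₀ Z t φ)
      (χcP Z t φ) (hχ0 Z t φ) (hχc0 Z t φ) (Dfam Z t) (Vk Z t φ) (hAhol Z t ht φ hφ) (hGhol Z t ht φ hφ)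
      (hVholb Z t ht φ hφ) (hχm Z t φ) (hχcm Z t φ) (hVm Z t ht φ hφ) (hAs Z t ht φ hφ) (hA Z t ht φ hφ)
      (qP Z t φ) (h222 Z t φ) hγ₂ (hqP Z t φ) ha0 (h220U Z t ht φ hφ) (hm Z t φ) (hfibN Z t φ) hκa hκb h2 h1
      hkap'' hsm (hθR1le Z t φ) hsmallKθ hc0 (hc Z t ht φ hφ) hαc hg (hΓq Z t ht φ hφ) hsmall hPa
      (hvol Z t ht φ hφ)
  exact differentiableOn_E_torus_param c hL hLc W P isOpen_ball (fun Z φ hφ t ht => (key Z φ hφ t ht).1)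
    (fun b hb Z φ hφ t ht => (key Z φ hφ t ht).2 b hb) hα₆ hε₀ hδ hδ7 hκ ha hR15 hR16 hR16' hR17 h231 ha₂ hκ229
    hsm229 habsk h18half h18 ha₂' hκ229' hsm229' hR20 ha₅ habs hAc hC3 hH hsp h213 hAct hr₁ hlarge hsmall41 hA₂

end Summit.QuantumFields.BalabanUV.T4Continuum.Spine.NE5.TwoRunTorusWalkOutputLetters

end
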